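import Summits.QuantumFields.YangMills.Theses.ParabolicTrajectory
import Literature.MathematicalPhysics.QuantumFieldTheory.BalabanRegulatorChart
import Summits.QuantumFields.YangMills.Theorems.BalabanStepParabolic.Negative.CurvatureOnly
import Summits.QuantumFields.YangMills.Theorems.BalabanStepParabolic.Negative.OrbitTransport

/-!
# `stub_realisation` of line `perfect-action-regulator-chart` (crux `BalabanStepParabolic`) — candidate proof

Refuter drefute certificate (refuter-drefute-stmt-QuantumFields-9684-0): the registered stub statement
`RealisationFromChartObservables` (skeleton v3, stated in full) is TRUE as typed. Witness exactly as in the stub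
docstring: chart `Ê = E × (ℝ × E)` (sup norm), `φ̂ g (y,s,w) = φ g y`, `Ψ̂ g (y,s,w) = (Ψ g y, g²/2, y/2)`,
`Â = (A ∘ fst, 0, fst/2)`, constants `max θ ½`, `max θ' ½`, `max C ½`, Wilson arc `(yW g, 0, 0)`, normalisations
`Negative.cInd r`, realisation functional by the in-chart / decoded-preimage case split.
-/

open scoped SchwartzMap
open MeasureTheory Filter Topology
open Literature.MathematicalPhysics.AQFT Literature.MathematicalPhysics.QuantumLattice
open Literature.Probability.LatticeModels
open Literature.MathematicalPhysics.QuantumFieldTheory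

noncomputable section

namespace Summit.QuantumFields.YangMills.Theorems.BalabanStepParabolic

namespace RealisationBridge

section Chart

variable {E : Type} [NormedAddCommGroup E] [NormedSpace ℝ E]

omit [NormedSpace ℝ E] in
/-- Sup-norm bound for a triple. -/
theorem norm_triple_le {a w : E} {s K : ℝ} (ha : ‖a‖ ≤ K) (hs : |s| ≤ K) (hw : ‖w‖ ≤ K) :
    ‖(a, (s, w))‖ ≤ K := by
  rw [Prod.norm_mk, Prod.norm_mk, Real.norm_eq_abs]
  exact max_le ha (max_le hs hw)

omit [NormedSpace ℝ E] in
theorem norm_fst_sub_le (x x' : E × (ℝ × E)) : ‖x.1 - x'.1‖ ≤ ‖x - x'‖ := by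
  rw [← Prod.fst_sub]; exact norm_fst_le _

/-- The injectivised fibre map `Ψ̂ g (y, s, w) = (Ψ g y, g²/2, y/2)`. -/
def hatΨ (Ψ : ℝ → E → E) (g : ℝ) (x : E × (ℝ × E)) : E × (ℝ × E) :=
  (Ψ g x.1, ((1 / 2 : ℝ) * g ^ 2, (1 / 2 : ℝ) • x.1))

/-- Its linear part `Â (y, s, w) = (A y, 0, y/2)`. -/
def hatA (A : E →L[ℝ] E) : E × (ℝ × E) →L[ℝ] E × (ℝ × E) :=
  (A.comp (ContinuousLinearMap.fst ℝ E (ℝ × E))).prod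
    ((0 : E × (ℝ × E) →L[ℝ] ℝ).prod ((1 / 2 : ℝ) • ContinuousLinearMap.fst ℝ E (ℝ × E)))

@[simp] theorem hatA_apply (A : E →L[ℝ] E) (x : E × (ℝ × E)) :
    hatA A x = (A x.1, (0, (1 / 2 : ℝ) • x.1)) := rfl

@[simp] theorem hatΨ_apply (Ψ : ℝ → E → E) (g : ℝ) (x : E × (ℝ × E)) :
    hatΨ Ψ g x = (Ψ g x.1, ((1 / 2 : ℝ) * g ^ 2, (1 / 2 : ℝ) • x.1)) := rfl

theorem norm_hatA_le (A : E →L[ℝ] E) {θ : ℝ} (hA : ‖A‖ ≤ θ) : ‖hatA A‖ ≤ max θ (1 / 2) := by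
  have hθ : 0 ≤ θ := (norm_nonneg A).trans hA
  refine ContinuousLinearMap.opNorm_le_bound _ (le_max_of_le_right (by norm_num)) fun x => ?_
  rw [hatA_apply]
  have hx1 : ‖x.1‖ ≤ ‖x‖ := norm_fst_le x
  have hm : 0 ≤ max θ (1 / 2) * ‖x‖ := by positivity
  refine norm_triple_le ?_ (by simp) ?_
  · calc ‖A x.1‖ ≤ ‖A‖ * ‖x.1‖ := A.le_opNorm _
      _ ≤ θ * ‖x‖ := mul_le_mul hA hx1 (norm_nonneg _) hθ
      _ ≤ max θ (1 / 2) * ‖x‖ := by gcongr; exact le_max_left _ _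
  · rw [norm_smul, Real.norm_eq_abs, abs_of_pos (by norm_num : (0 : ℝ) < 1 / 2)]
    calc (1 / 2 : ℝ) * ‖x.1‖ ≤ (1 / 2) * ‖x‖ := by gcongr
      _ ≤ max θ (1 / 2) * ‖x‖ := by gcongr; exact le_max_right _ _

variable {φ : ℝ → E → ℝ} {Ψ : ℝ → E → E} {A : E →L[ℝ] E} {b C δ R θ' : ℝ}

/-- The parabolic block transfers to the injectivised chart with constant `max C ½`. -/
theorem hat_parabolicBlock (hPB : ParabolicBlock E φ Ψ A b C δ) (hC : 0 ≤ C) :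
    ParabolicBlock (E × (ℝ × E)) (fun g x => φ g x.1) (hatΨ Ψ) (hatA A) b (max C (1 / 2)) δ := by
  obtain ⟨hrem, hfib, hbase⟩ := hPB
  have hCle : C ≤ max C (1 / 2) := le_max_left _ _
  have hεle : (1 / 2 : ℝ) ≤ max C (1 / 2) := le_max_right _ _
  have hC0 : 0 ≤ max C (1 / 2) := hC.trans hCle
  refine ⟨fun g x hg hx => ?_, fun g x x' hg hx hx' => ?_, fun g g' x hg hg' hx => ?_⟩
  · -- remainder
    have hx1 : ‖x.1‖ ≤ ‖x‖ := norm_fst_le x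
    obtain ⟨h1, h2⟩ := hrem g x.1 hg (hx1.trans hx)
    refine ⟨h1.trans ?_, ?_⟩
    · have h3 : 0 ≤ |g| ^ 3 := by positivity
      calc C * (g ^ 4 + |g| ^ 3 * ‖x.1‖) ≤ C * (g ^ 4 + |g| ^ 3 * ‖x‖) := by gcongr
        _ ≤ max C (1 / 2) * (g ^ 4 + |g| ^ 3 * ‖x‖) := by gcongr
    · have heq : hatΨ Ψ g x - hatA A x = (Ψ g x.1 - A x.1, ((1 / 2 : ℝ) * g ^ 2, 0)) := by
        simp [hatΨ]
      rw [heq]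
      have hsq : g ^ 2 ≤ g ^ 2 + ‖x‖ ^ 2 := by nlinarith [norm_nonneg x]
      refine norm_triple_le ?_ ?_ ?_
      · calc ‖Ψ g x.1 - A x.1‖ ≤ C * (g ^ 2 + ‖x.1‖ ^ 2) := h2
          _ ≤ C * (g ^ 2 + ‖x‖ ^ 2) := by gcongr
          _ ≤ max C (1 / 2) * (g ^ 2 + ‖x‖ ^ 2) := by gcongr
      · rw [abs_of_nonneg (by positivity)]
        calc (1 / 2 : ℝ) * g ^ 2 ≤ max C (1 / 2) * g ^ 2 := by gcongr
          _ ≤ max C (1 / 2) * (g ^ 2 + ‖x‖ ^ 2) := by gcongr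
      · rw [norm_zero]; positivity
  · -- lipschitz_fibre
    have hx1 : ‖x.1‖ ≤ ‖x‖ := norm_fst_le x
    have hx1' : ‖x'.1‖ ≤ ‖x'‖ := norm_fst_le x'
    have hd : ‖x.1 - x'.1‖ ≤ ‖x - x'‖ := norm_fst_sub_le x x'
    obtain ⟨h1, h2⟩ := hfib g x.1 x'.1 hg (hx1.trans hx) (hx1'.trans hx')
    refine ⟨?_, ?_⟩
    · show |φ g x.1 - φ g x'.1| ≤ max C (1 / 2) * |g| ^ 3 * ‖x - x'‖
      have h3 : 0 ≤ |g| ^ 3 := by positivity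
      calc |φ g x.1 - φ g x'.1| ≤ C * |g| ^ 3 * ‖x.1 - x'.1‖ := h1
        _ ≤ C * |g| ^ 3 * ‖x - x'‖ := by gcongr
        _ ≤ max C (1 / 2) * |g| ^ 3 * ‖x - x'‖ := by gcongr
    · have heq : hatΨ Ψ g x - hatΨ Ψ g x' - hatA A (x - x') =
          (Ψ g x.1 - Ψ g x'.1 - A (x.1 - x'.1), (0, 0)) := by
        simp [hatΨ, smul_sub, Prod.ext_iff]
      rw [heq]
      have hK : 0 ≤ max C (1 / 2) * (|g| + ‖x‖ + ‖x'‖) * ‖x - x'‖ := by positivity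
      refine norm_triple_le ?_ (by simpa using hK) (by simpa using hK)
      calc ‖Ψ g x.1 - Ψ g x'.1 - A (x.1 - x'.1)‖ ≤ C * (|g| + ‖x.1‖ + ‖x'.1‖) * ‖x.1 - x'.1‖ := h2
        _ ≤ C * (|g| + ‖x‖ + ‖x'‖) * ‖x - x'‖ := by gcongr
        _ ≤ max C (1 / 2) * (|g| + ‖x‖ + ‖x'‖) * ‖x - x'‖ := by gcongr
  · -- lipschitz_base
    have hx1 : ‖x.1‖ ≤ ‖x‖ := norm_fst_le x
    obtain ⟨h1, h2⟩ := hbase g g' x.1 hg hg' (hx1.trans hx)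
    have hm0 : 0 ≤ max |g| |g'| := le_max_of_le_left (abs_nonneg g)
    refine ⟨?_, ?_⟩
    · show |φ g x.1 - φ g' x.1 - (g - g') - b * (g ^ 3 - g' ^ 3)| ≤
          max C (1 / 2) * max |g| |g'| ^ 2 * (max |g| |g'| + ‖x‖) * |g - g'|
      refine h1.trans ?_
      gcongr
    · have heq : hatΨ Ψ g x - hatΨ Ψ g' x =
          (Ψ g x.1 - Ψ g' x.1, ((1 / 2 : ℝ) * ((g + g') * (g - g')), 0)) := by
        simp [hatΨ, Prod.ext_iff]; ring
      rw [heq]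
      have hK : 0 ≤ max C (1 / 2) * (|g| + |g'| + ‖x‖) * |g - g'| := by positivity
      refine norm_triple_le ?_ ?_ (by simpa using hK)
      · refine h2.trans ?_
        gcongr
      · rw [abs_mul, abs_mul, abs_of_pos (by norm_num : (0 : ℝ) < 1 / 2)]
        calc (1 / 2 : ℝ) * (|g + g'| * |g - g'|) ≤ (1 / 2) * ((|g| + |g'| + ‖x‖) * |g - g'|) := by
              gcongr
              exact (abs_add_le g g').trans (le_add_of_nonneg_right (norm_nonneg _))
          _ = (1 / 2) * (|g| + |g'| + ‖x‖) * |g - g'| := by ring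
          _ ≤ max C (1 / 2) * (|g| + |g'| + ‖x‖) * |g - g'| := by gcongr

/-- The basin block transfers with contraction rate `max θ' ½` and constant `max C ½`. -/
theorem hat_basinBlock (hBB : BasinBlock E φ Ψ b C δ R θ') (hC : 0 ≤ C) (hθ' : 0 ≤ θ') :
    BasinBlock (E × (ℝ × E)) (fun g x => φ g x.1) (hatΨ Ψ) b (max C (1 / 2)) δ R (max θ' (1 / 2)) := by
  obtain ⟨hcon, hrem⟩ := hBB
  refine ⟨fun g x x' hg hx hx' => ?_, fun g x hg hx => ?_⟩
  · have hx1 : ‖x.1‖ ≤ ‖x‖ := norm_fst_le x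
    have hx1' : ‖x'.1‖ ≤ ‖x'‖ := norm_fst_le x'
    have hd : ‖x.1 - x'.1‖ ≤ ‖x - x'‖ := norm_fst_sub_le x x'
    have h := hcon g x.1 x'.1 hg (hx1.trans hx) (hx1'.trans hx')
    have heq : hatΨ Ψ g x - hatΨ Ψ g x' = (Ψ g x.1 - Ψ g x'.1, (0, (1 / 2 : ℝ) • (x.1 - x'.1))) := by
      simp [hatΨ, smul_sub]
    rw [heq]
    have hK : 0 ≤ max θ' (1 / 2) * ‖x - x'‖ := by positivity
    refine norm_triple_le ?_ (by simp) ?_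
    · calc ‖Ψ g x.1 - Ψ g x'.1‖ ≤ θ' * ‖x.1 - x'.1‖ := h
        _ ≤ θ' * ‖x - x'‖ := by gcongr
        _ ≤ max θ' (1 / 2) * ‖x - x'‖ := by gcongr; exact le_max_left _ _
    · rw [norm_smul, Real.norm_eq_abs, abs_of_pos (by norm_num : (0 : ℝ) < 1 / 2)]
      calc (1 / 2 : ℝ) * ‖x.1 - x'.1‖ ≤ (1 / 2) * ‖x - x'‖ := by gcongr
        _ ≤ max θ' (1 / 2) * ‖x - x'‖ := by gcongr; exact le_max_right _ _
  · have hx1 : ‖x.1‖ ≤ ‖x‖ := norm_fst_le x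
    have h := hrem g x.1 hg (hx1.trans hx)
    show |φ g x.1 - (g + b * g ^ 3)| ≤ max C (1 / 2) * (g ^ 4 + |g| ^ 3 * ‖x‖)
    refine h.trans ?_
    have h3 : 0 ≤ |g| ^ 3 := by positivity
    calc C * (g ^ 4 + |g| ^ 3 * ‖x.1‖) ≤ C * (g ^ 4 + |g| ^ 3 * ‖x‖) := by gcongr
      _ ≤ max C (1 / 2) * (g ^ 4 + |g| ^ 3 * ‖x‖) := by gcongr; exact le_max_left _ _

end Chart

/-! ### The realisation functional on the injectivised chart -/

section Expect

variable {G : Type} [Group G] [TopologicalSpace G] [IsTopologicalGroup G] [CompactSpace G]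
  [MeasurableSpace G] [BorelSpace G] (r : LatticeRep G) (M : ℕ)
  {E : Type} [NormedAddCommGroup E] [NormedSpace ℝ E]
  (δ R : ℝ) (corr : ℝ × E → ℕ → (n : ℕ) → (Fin n → 𝓢(EuclideanSpace ℝ (Fin 4), ℝ)) → ℝ)

open Classical in
/-- `expect (g', (y', s', w')) S n σ f`: `0` on mixed species strings; `corr (g', y') S n f` in the chart;
the decoded preimage value `corr (√(2 s'), 2 w') (M S) n (blockDilate M ∘ f)` out of the chart. -/
def hatExpect (p : ℝ × (E × (ℝ × E))) (S : ℕ) (n : ℕ) (σ : Fin n → YMSpecies G)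
    (f : Fin n → 𝓢(EuclideanSpace ℝ (Fin 4), ℝ)) : ℝ :=
  if (∃ i, σ i ≠ r.curvature) then 0
  else if p.1 ∈ Set.Icc 0 δ ∧ ‖p.2.1‖ ≤ R then corr (p.1, p.2.1) S n f
  else corr (Real.sqrt (2 * p.2.2.1), (2 : ℝ) • p.2.2.2) (M * S) n (fun i => blockDilate M (f i))

variable {r M δ R corr}

theorem hatExpect_of_mixed {p : ℝ × (E × (ℝ × E))} {S n : ℕ} {σ : Fin n → YMSpecies G}
    (h : ∃ i, σ i ≠ r.curvature) (f : Fin n → 𝓢(EuclideanSpace ℝ (Fin 4), ℝ)) :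
    hatExpect r M δ R corr p S n σ f = 0 := by
  unfold hatExpect; rw [if_pos h]

theorem hatExpect_of_mem {p : ℝ × (E × (ℝ × E))} {S n : ℕ} {σ : Fin n → YMSpecies G}
    (h : ¬ ∃ i, σ i ≠ r.curvature) (hp : p.1 ∈ Set.Icc 0 δ ∧ ‖p.2.1‖ ≤ R)
    (f : Fin n → 𝓢(EuclideanSpace ℝ (Fin 4), ℝ)) :
    hatExpect r M δ R corr p S n σ f = corr (p.1, p.2.1) S n f := by
  unfold hatExpect; rw [if_neg h, if_pos hp]

theorem hatExpect_of_not_mem {p : ℝ × (E × (ℝ × E))} {S n : ℕ} {σ : Fin n → YMSpecies G}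
    (h : ¬ ∃ i, σ i ≠ r.curvature) (hp : ¬ (p.1 ∈ Set.Icc 0 δ ∧ ‖p.2.1‖ ≤ R))
    (f : Fin n → 𝓢(EuclideanSpace ℝ (Fin 4), ℝ)) :
    hatExpect r M δ R corr p S n σ f =
      corr (Real.sqrt (2 * p.2.2.1), (2 : ℝ) • p.2.2.2) (M * S) n (fun i => blockDilate M (f i)) := by
  unfold hatExpect; rw [if_neg h, if_neg hp]

end Expect

end RealisationBridge

open RealisationBridge in
/-- **Stub 3 — chart observables ⇒ the structure's realisation block** (`RealisationFromChartObservables`, TRUE as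
typed). [folklore] -/
theorem realisationFromChartObservables :
    ∀ (G : Type) [Group G] [TopologicalSpace G] [IsTopologicalGroup G] [CompactSpace G]
      [MeasurableSpace G] [BorelSpace G] (r : LatticeRep G) (M : ℕ)
      (E : Type) [NormedAddCommGroup E] [NormedSpace ℝ E] [CompleteSpace E]
      (φ : ℝ → E → ℝ) (Ψ : ℝ → E → E) (A : E →L[ℝ] E) (b₀ θ C δ R θ' : ℝ),
      2 ≤ M → 0 < b₀ → 0 ≤ θ → θ < 1 → ‖A‖ ≤ θ → 0 < C → 0 < δ → δ ≤ R → 0 ≤ θ' → θ' < 1 →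
      ParabolicBlock E φ Ψ A (b₀ * Real.log M) C δ →
      BasinBlock E φ Ψ (b₀ * Real.log M) C δ R θ' →
      ∀ (yW : ℝ → E) (g₀ : ℝ) (betaOf : ℝ → ℝ) (κ K : ℝ)
        (corr : ℝ × E → ℕ → (n : ℕ) → (Fin n → 𝓢(EuclideanSpace ℝ (Fin 4), ℝ)) → ℝ),
        ChartRealisationData G r M E φ Ψ δ R yW g₀ betaOf κ K corr →
        Nonempty (BalabanBanachStep G r M) := by
  intro G _ _ _ _ _ _ r M E _ _ _ φ Ψ A b₀ θ C δ R θ' hM hb₀ _hθ0 hθ1 hA _hC hδ hδR hθ'0 hθ'1 hPB hBB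
    yW g₀ betaOf κ K corr hCR
  have hPB' := hat_parabolicBlock hPB _hC.le
  have hBB' := hat_basinBlock hBB _hC.le hθ'0
  have hR0 : 0 ≤ R := hδ.le.trans hδR
  have hlogM : 0 < Real.log M := Real.log_pos (by exact_mod_cast (lt_of_lt_of_le one_lt_two hM))
  exact ⟨{
    E := E × (ℝ × E)
    φ := fun g x => φ g x.1
    Ψ := hatΨ Ψ
    A := hatA A
    b := b₀ * Real.log M
    θ := max θ (1 / 2)
    C := max C (1 / 2)
    δ := δ
    b_pos := mul_pos hb₀ hlogM
    θ_nonneg := le_max_of_le_right (by norm_num)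
    θ_lt_one := max_lt hθ1 (by norm_num)
    C_pos := lt_max_of_lt_right (by norm_num)
    δ_pos := hδ
    norm_A_le := norm_hatA_le A hA
    remainder := hPB'.1
    lipschitz_fibre := hPB'.2.1
    lipschitz_base := hPB'.2.2
    b₀ := b₀
    b_eq := rfl
    R := R
    δ_le_R := hδR
    θ' := max θ' (1 / 2)
    θ'_nonneg := le_max_of_le_right (by norm_num)
    θ'_lt_one := max_lt hθ'1 (by norm_num)
    contraction := hBB'.1
    remainder_basin := hBB'.2
    yW := fun g => (yW g, ((0 : ℝ), (0 : E)))
    g₀ := g₀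
    g₀_pos := hCR.g₀_pos
    continuousOn_yW := hCR.continuousOn_yW.prodMk continuousOn_const
    norm_yW_le := fun g hg => norm_triple_le (hCR.norm_yW_le g hg) (by simpa using hR0) (by simpa using hR0)
    betaOf := betaOf
    strictAntiOn_betaOf := hCR.strictAntiOn_betaOf
    continuousOn_betaOf := hCR.continuousOn_betaOf
    κ := κ
    κ_pos := hCR.κ_pos
    K := K
    betaOf_sub_le := hCR.betaOf_sub_le
    c := fun _ => Negative.cInd r
    c_curvature := fun _ => Negative.cInd_curvature r
    expect := hatExpect r M δ R corr
    expect_step := by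
      intro g x hg hx S n σ f
      have hy : ‖x.1‖ ≤ R := (norm_fst_le x).trans hx
      by_cases hσ : ∃ i, σ i ≠ r.curvature
      · rw [hatExpect_of_mixed hσ, hatExpect_of_mixed hσ]
      · rw [hatExpect_of_mem (p := (g, x)) hσ ⟨hg, hy⟩]
        by_cases hin : φ g x.1 ∈ Set.Icc 0 δ ∧ ‖Ψ g x.1‖ ≤ R
        · rw [hatExpect_of_mem (p := (φ g x.1, hatΨ Ψ g x)) hσ (by simpa using hin)]
          exact hCR.corr_step g x.1 hg hy hin.1 hin.2 S n f
        · rw [hatExpect_of_not_mem (p := (φ g x.1, hatΨ Ψ g x)) hσ (by simpa using hin)]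
          simp only [hatΨ_apply, smul_smul]
          have h2 : (2 : ℝ) * (1 / 2 * g ^ 2) = g ^ 2 := by ring
          rw [h2, Real.sqrt_sq hg.1]
          norm_num
    expect_wilson := by
      intro g hg L n σ f
      by_cases hσ : ∃ i, σ i ≠ r.curvature
      · rw [hatExpect_of_mixed hσ]
        exact (Negative.wilsonCentredSchwinger_cInd_of_exists r (betaOf g) L n hσ f).symm
      · have hmem : g ∈ Set.Icc 0 δ ∧ ‖yW g‖ ≤ R :=
          ⟨⟨hg.1.le, hg.2.trans hCR.g₀_le_δ⟩, hCR.norm_yW_le g ⟨hg.1.le, hg.2⟩⟩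
        rw [hatExpect_of_mem (p := (g, (yW g, ((0 : ℝ), (0 : E))))) hσ (by simpa using hmem)]
        push Not at hσ
        obtain rfl : σ = fun _ => r.curvature := funext hσ
        rw [hCR.corr_wilson g hg L n f]
        exact Negative.wilsonCentredSchwinger_congr_c r.ρ (betaOf g) L (fun i => by simp) f
    continuousOn_expect := by
      intro S n σ f hf
      by_cases hσ : ∃ i, σ i ≠ r.curvature
      · exact continuousOn_const.congr fun p _ => hatExpect_of_mixed hσ f
      · have hmaps : Set.MapsTo (fun q : ℝ × (E × (ℝ × E)) => (q.1, q.2.1))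
            (Set.Icc 0 δ ×ˢ Metric.closedBall 0 R) (Set.Icc 0 δ ×ˢ Metric.closedBall 0 R) := by
          intro q hq
          refine Set.mk_mem_prod hq.1 ?_
          have h2 : ‖q.2‖ ≤ R := mem_closedBall_zero_iff.mp hq.2
          exact mem_closedBall_zero_iff.mpr ((norm_fst_le q.2).trans h2)
        have hcont : ContinuousOn ((fun p : ℝ × E => corr p S n f) ∘
            fun q : ℝ × (E × (ℝ × E)) => (q.1, q.2.1)) (Set.Icc 0 δ ×ˢ Metric.closedBall 0 R) :=
          (hCR.corr_continuousOn S n f hf).comp (by fun_prop) hmaps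
        refine hcont.congr fun q hq => ?_
        have h2 : ‖q.2‖ ≤ R := mem_closedBall_zero_iff.mp hq.2
        exact hatExpect_of_mem hσ ⟨hq.1, (norm_fst_le q.2).trans h2⟩ f }⟩

end Summit.QuantumFields.YangMills.Theorems.BalabanStepParabolic

end
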